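import Mathlib
import Literature.MathematicalPhysics.QuantumFieldTheory.Balaban1983to89.B5

/-!
# Bałaban, *Propagators and renormalization transformations for lattice gauge theories. I*
(Commun. Math. Phys. **95** (1984) 17–40) — Sect. D, the properties of `H_k` (p. 29), from the
representation (1.60), kernel-checked as logic

[cite: Balaban1984PropagatorsI, p.29 after (1.63); (1.38) p.24; (1.55)–(1.60) pp.27–28; (1.69) p.29]

## The printed text (renders `1984-cmp95-propagators-rt-I-p008/p011/p012/p013-x2.png`, read as images)

p. 29 [PDF 13], after (1.63): «Using (1.60), or better (1.63), we can verify all the properties of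
H_kB: Q_kH_kB = B, R∂*H_kB = 0, H_kB is a minimum of ½⟨∂A, ∂A⟩ on the hyperplane {A:Q_kA = B,
R∂*A = 0}, which means that ⟨∂A′, ∂H_kB⟩ = 0 on the subspace {A′:Q_kA′ = 0, R∂*A′ = 0}.» — typed
verbatim in the tree as `B5.HkPropsPrinted` over the carrier `B5.HkData`.
p. 24 [PDF 8]: «Let us denote the projection operator by R, so we have
R = I − Δ⁻¹Q′_k*Q′_kΔ⁻²Q′_k*)⁻¹Q′_kΔ⁻¹.  (1.38)» (an opening parenthesis is missing in print; read
`R = I − Δ⁻¹Q′_k*(Q′_kΔ⁻²Q′_k*)⁻¹Q′_kΔ⁻¹`, cell GAPS G-B5-14 (i)).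
p. 27 [PDF 11]: (1.55) «Q_k∂ = ∂₁Q′_k»; «Taking the decomposition B = B′ + B₀, where B₀ is a constant
configuration and B′ is in the orthogonal subspace, we can identify Q_kA₀ = B₀, or A₀ = Q_k*B₀»;
«φ = Q_kΔ⁻¹Q_k*.  (1.58)»; «… λ′ = (∂₁*φ⁻¹∂₁)⁻¹∂₁*φ⁻¹B′.» (the solvability condition
«∂₁*ω = ∂₁*φ⁻¹∂₁λ′ − ∂₁*φ⁻¹B′ = 0»).
p. 28 [PDF 12], (1.60): «H_kB = Δ⁻¹Q_k*φ⁻¹B′ + [∂Δ⁻²Q′_k*(Q′_kΔ⁻²Q′_k*)⁻¹ − Δ⁻¹Q_k*φ⁻¹∂₁](∂₁*φ⁻¹∂₁)⁻¹∂₁*φ⁻¹B′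
+ Q_k*B₀».
p. 29 [PDF 13], (1.69): «Δ = ∂*∂ + ∂∂*».

## What this module certifies (kernel) and what it does not

The three properties of the p. 29 sentence, for `H_kB` GIVEN BY (1.60), as LOGIC over abstract real
inner-product spaces (`V` vector fields on `T_η`, `W` vector fields on `T₁^{(k)}`, `S` / `S₁` scalars
on `T_η` / `T₁^{(k)}`, `P` plaquette fields; universe `Type`, as the fields of `B5.HkData`), the
operators bundled in `OpData` and the printed identities they obey bundled as the hypothesis
`OpData.Laws` — each field one numbered identity of the paper or a definition: (1.69) in polarised
form `⟨A′, ΔA⟩ = ⟨∂A′, ∂A⟩ + ⟨∂*A′, ∂*A⟩`; `Q_k*` the adjoint of `Q_k`; (1.55) `Q_k∂ = ∂₁Q′_k` and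
its adjoint `∂*Q_k* = Q′_k*∂₁*`; `∂*Δ⁻¹ = Δ⁻¹∂*`; `∂∂ = 0`; (1.38); the normal equation
`∂₁*φ⁻¹(B′ − ∂₁λ′) = 0` of `λ′ = Lam B`; `B₀ = P₀B` constant: `Q_kQ_k*B₀ = B₀` («Q_kA₀ = B₀,
A₀ = Q_k*B₀»), `∂Q_k*B₀ = 0`, `∂₁*B₀ = 0`, and `P₀∂₁ = 0` («B′ is in the orthogonal subspace»: `∂₁λ`
has no constant part); and the four INVERSES, asserted only on the orthogonal complement of the
constants, where print has them (p. 27 l. 1 «ω is orthogonal to constant functions», «A′ is orthogonal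
to constant functions also»), in the range/pointwise forms the verification uses (v1.1, see below):
`ΔΔ⁻¹ = I` on `Q_k*φ⁻¹W`; (1.58) with `φφ⁻¹ = I` on `{B − B₀}`, as `Q_kΔ⁻¹Q_k*φ⁻¹(B − P₀B) = B − P₀B`;
`∂*∂Δ⁻¹ = I` on `Δ⁻¹S` (on scalars `Δ = ∂*∂`); `(Q′_kΔ⁻²Q′_k*)E λ′ = λ′` and `E(Q′_kΔ⁻²Q′_k*)E = E`
(`E = (Q′_kΔ⁻²Q′_k*)⁻¹`).

* `OpData.H` = (1.60) in its printed grouping, with `λ′ = Lam B`, `B′ = B − P₀B`, `B₀ = P₀B`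
  (`H_eq`: = `Δ⁻¹Q_k*φ⁻¹(B′ − ∂₁λ′) + ∂ω + Q_k*B₀`, `ω = Δ⁻²Q′_k*(Q′_kΔ⁻²Q′_k*)⁻¹λ′`).
* (i) `Q_H`: `Q_kH_kB = B`.  (ii) `dv_H`: `∂*H_kB = Δ⁻¹Q′_k*(Q′_kΔ⁻²Q′_k*)⁻¹λ′`, and `R_dv_H`:
  `R∂*H_kB = 0` (via `R_Gs_Q's`: (1.38) gives `RΔ⁻¹Q′_k*E = 0`).  (iii) `inner_curl_H`:
  `⟨∂A′, ∂H_kB⟩ = 0` for EVERY `A′` with `Q_kA′ = 0` — the gauge condition on `A′` is not needed —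
  and `energy_H_le`: `½‖∂H_kB‖² ≤ ½‖∂A‖²` for every `A` with `Q_kA = B` (so a fortiori on the printed
  hyperplane); `normSq_curl_eq`: `‖∂A‖² = ‖∂H_kB‖² + ‖∂(A − H_kB)‖²` for `Q_kA = B` (the quadratic
  part of p. 29 «We make the translation A = A′ + H_kB»).
* `hkPropsPrinted_of_laws`: `B5.HkPropsPrinted (OpData.hkData O)` BY NAME, for the `HkData` whose
  `Q` is `Q_k`, `gauge A := (R∂*A = 0)`, `energy A := ½‖∂A‖²`, `H := OpData.H`.

This completes, at kernel level and in the (1.60) representation, the cell's prose certificate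
GAPS C-adv4-31 (i)–(iii) («(iii) is the piece not yet in the tree»); `B5.hk_props` is (i)–(ii) in
the Sect. E representation (1.95)/(1.103).

v1.1 (same session as v1; hypotheses WEAKENED only, every theorem name and conclusion unchanged): in v1
the inverse identities `hG`, `h158`, `hsc`, `hEr`, `hEl` were universal (`ΔΔ⁻¹ = I` on all of `V`, …);
on `T_η` the Laplacians, `φ` and `Q′_kΔ⁻²Q′_k*` have the constants as zero modes, so the universal forms
are satisfiable by the concrete operators only on the ⊥-constant subspaces, where `B₀` would be forced
to `0` (cell GAPS G-pv01-39, cross-read remark T1 on the sibling module `B5Action165Lagrange`).  v1.1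
asserts them only where they are used — on vectors orthogonal to the constants — so that `OpData.Laws`
is satisfiable verbatim by the pseudo-inverse instantiation (`G = Δ⁺`, `φinv = φ⁺`, `Gs = Δ⁺` on
scalars, `E = (Q′_kΔ⁺²Q′_k*)⁺`, `P₀` = projection onto constants, `Lam B` = the ⊥-constant solution
of the normal equation) on the FULL spaces with `B₀ ≠ 0`; `hP₀g` (`P₀∂₁ = 0`) is new.

HONEST SCOPE.  NOT certified here: that Bałaban's concrete operators on `T_η` (Q_k of (1.30), Q′_k of
(1.55), ∂, ∂*, Δ of (1.69), R of (1.38), φ of (1.58)) satisfy `OpData.Laws` — each field is a standard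
finite-lattice identity or an invertibility printed in Sects. C–D (Δ on fields ⊥ constants,
Q′_kΔ⁻²Q′_k*, φ, ∂₁*φ⁻¹∂₁ on scalars ⊥ constants), prose-certified in GAPS C-adv4-30/31/32 and
cross-checked numerically in C-B5-9 (E6: (1.60) = the constrained minimiser to ≤ 2·10⁻¹²); the same
located residual as GAPS G-pv15g4-2.  Nothing about (1.63), Z_k, or Proposition 1.2.  No statement
of the paper is used as a hypothesis of anything but the abstract theorems here, whose hypotheses are
explicit binders discharged by nobody in this file.
-/

noncomputable section

namespace Literature.MathematicalPhysics.QuantumFieldTheory.Balaban1983to89.B5HkProperties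

open scoped InnerProductSpace
open Literature.MathematicalPhysics.QuantumFieldTheory.Balaban1983to89.B5 (HkData HkPropsPrinted)

variable {V W S S₁ P : Type}
  [NormedAddCommGroup V] [InnerProductSpace ℝ V]
  [NormedAddCommGroup W] [InnerProductSpace ℝ W]
  [NormedAddCommGroup S] [InnerProductSpace ℝ S]
  [NormedAddCommGroup S₁] [InnerProductSpace ℝ S₁]
  [NormedAddCommGroup P] [InnerProductSpace ℝ P]

variable (V W S S₁ P) in
/-- The operators of Sects. C–D as abstract linear maps: `curl = ∂` on vector fields of `T_η`,
`dv = ∂*`, `grad = ∂` on scalars, `Δ` and `G = Δ⁻¹` on vector fields, `Q = Q_k`, `Qs = Q_k*`,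
`φinv = φ⁻¹` ((1.58)), `grad₁ = ∂₁`, `dv₁ = ∂₁*`, `Q' = Q′_k`, `Q's = Q′_k*`, `Gs = Δ⁻¹` on scalars,
`E = (Q′_kΔ⁻²Q′_k*)⁻¹`, `R` ((1.38)), `P₀` = the projection `B ↦ B₀` onto constant configurations
(«B = B′ + B₀»), `Lam` = `B ↦ λ′ = (∂₁*φ⁻¹∂₁)⁻¹∂₁*φ⁻¹B′` (p. 27).  Data only; the identities
they satisfy are `OpData.Laws`. [cite: Balaban1984PropagatorsI, (1.30), (1.38), (1.55)–(1.60), (1.69)] -/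
structure OpData where
  curl : V →ₗ[ℝ] P
  dv : V →ₗ[ℝ] S
  grad : S →ₗ[ℝ] V
  Δ : V →ₗ[ℝ] V
  G : V →ₗ[ℝ] V
  Q : V →ₗ[ℝ] W
  Qs : W →ₗ[ℝ] V
  φinv : W →ₗ[ℝ] W
  grad₁ : S₁ →ₗ[ℝ] W
  dv₁ : W →ₗ[ℝ] S₁
  Q' : S →ₗ[ℝ] S₁
  Q's : S₁ →ₗ[ℝ] S
  Gs : S →ₗ[ℝ] S
  E : S₁ →ₗ[ℝ] S₁
  R : S →ₗ[ℝ] S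
  P₀ : W →ₗ[ℝ] W
  Lam : W →ₗ[ℝ] S₁

namespace OpData

variable (O : OpData V W S S₁ P)

/-- The printed identities used on p. 29, as hypotheses on the abstract operators (each field is a
numbered identity of the paper, an adjointness, an invertibility printed in Sects. C–D, or the
definition of `B₀`, `λ′`): `h169` (1.69) `Δ = ∂*∂ + ∂∂*` with `∂*` the adjoint of `∂`, polarised;
`hG` `ΔΔ⁻¹ = I` on `Q_k*φ⁻¹W` (⊥ constants); `hadj` `Q_k*` is the adjoint of `Q_k`; `h158` (1.58)
`φ = Q_kΔ⁻¹Q_k*` with `φφ⁻¹ = I` on `B − B₀` (⊥ constants); `hP₀g` `P₀∂₁ = 0` (`∂₁λ` ⊥ constants);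
`h155` (1.55) `Q_k∂ = ∂₁Q′_k`; `h155s` its adjoint `∂*Q_k* = Q′_k*∂₁*`; `hcomm` `∂*Δ⁻¹ = Δ⁻¹∂*`;
`hsc` `∂*∂Δ⁻¹ = I` on `Δ⁻¹S` (scalars ⊥ constants); `hdd` `∂∂ = 0`; `hEr` `(Q′_kΔ⁻²Q′_k*)Eλ′ = λ′`
(`λ′` ⊥ constants) and `hEl` `E(Q′_kΔ⁻²Q′_k*)E = E`, `E = (Q′_kΔ⁻²Q′_k*)⁻¹`; `h138` (1.38)
`R = I − Δ⁻¹Q′_k*(Q′_kΔ⁻²Q′_k*)⁻¹Q′_kΔ⁻¹`; `hΛ` the normal equation `∂₁*φ⁻¹(B′ − ∂₁λ′) = 0` (p. 27,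
«∂₁*ω = 0», «λ′ = (∂₁*φ⁻¹∂₁)⁻¹∂₁*φ⁻¹B′») with `B′ = B − P₀B`; `hQB₀` «Q_kA₀ = B₀, A₀ = Q_k*B₀»;
`hB₀c` `∂(Q_k*B₀) = 0` and `hB₀d` `∂₁*B₀ = 0` (B₀ constant).  The inverses are asserted only on vectors
orthogonal to the constants (v1.1; p. 27 l. 1).  Hypotheses, never asserted of any concrete operator
here. [cite: Balaban1984PropagatorsI, (1.38) p.24, (1.55)–(1.58) p.27, (1.69) p.29] -/
structure Laws : Prop where
  h169 : ∀ A' A : V, ⟪A', O.Δ A⟫_ℝ = ⟪O.curl A', O.curl A⟫_ℝ + ⟪O.dv A', O.dv A⟫_ℝ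
  hG : ∀ u : W, O.Δ (O.G (O.Qs (O.φinv u))) = O.Qs (O.φinv u)
  hadj : ∀ (A : V) (y : W), ⟪O.Q A, y⟫_ℝ = ⟪A, O.Qs y⟫_ℝ
  h158 : ∀ y : W, O.Q (O.G (O.Qs (O.φinv (y - O.P₀ y)))) = y - O.P₀ y
  hP₀g : ∀ t : S₁, O.P₀ (O.grad₁ t) = 0
  h155 : ∀ s : S, O.Q (O.grad s) = O.grad₁ (O.Q' s)
  h155s : ∀ y : W, O.dv (O.Qs y) = O.Q's (O.dv₁ y)
  hcomm : ∀ v : V, O.dv (O.G v) = O.Gs (O.dv v)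
  hsc : ∀ s : S, O.dv (O.grad (O.Gs (O.Gs s))) = O.Gs s
  hdd : ∀ s : S, O.curl (O.grad s) = 0
  hEr : ∀ B : W, O.Q' (O.Gs (O.Gs (O.Q's (O.E (O.Lam B))))) = O.Lam B
  hEl : ∀ t : S₁, O.E (O.Q' (O.Gs (O.Gs (O.Q's (O.E t))))) = O.E t
  h138 : ∀ s : S, O.R s = s - O.Gs (O.Q's (O.E (O.Q' (O.Gs s))))
  hΛ : ∀ B : W, O.dv₁ (O.φinv ((B - O.P₀ B) - O.grad₁ (O.Lam B))) = 0
  hQB₀ : ∀ B : W, O.Q (O.Qs (O.P₀ B)) = O.P₀ B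
  hB₀c : ∀ B : W, O.curl (O.Qs (O.P₀ B)) = 0
  hB₀d : ∀ B : W, O.dv₁ (O.P₀ B) = 0

/-- `B′ = B − B₀` («B = B′ + B₀», p. 27). [cite: Balaban1984PropagatorsI, p.27 before (1.56)] -/
def Bp (B : W) : W := B - O.P₀ B

/-- `ω = Δ⁻²Q′_k*(Q′_kΔ⁻²Q′_k*)⁻¹λ′`, the scalar field under `∂` in the bracket of (1.60).
[cite: Balaban1984PropagatorsI, (1.60) p.28] -/
def ω (B : W) : S := O.Gs (O.Gs (O.Q's (O.E (O.Lam B))))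

/-- `A* = Δ⁻¹Q_k*φ⁻¹(B′ − ∂₁λ′)`, the first term of (1.60) regrouped with the `Δ⁻¹Q_k*φ⁻¹∂₁` part of
the bracket. [cite: Balaban1984PropagatorsI, (1.60) p.28] -/
def Astar (B : W) : V := O.G (O.Qs (O.φinv (O.Bp B - O.grad₁ (O.Lam B))))

/-- **(1.60) as printed**: `H_kB = Δ⁻¹Q_k*φ⁻¹B′ + [∂Δ⁻²Q′_k*(Q′_kΔ⁻²Q′_k*)⁻¹ − Δ⁻¹Q_k*φ⁻¹∂₁]λ′
+ Q_k*B₀` with `λ′ = (∂₁*φ⁻¹∂₁)⁻¹∂₁*φ⁻¹B′ = Lam B`. [cite: Balaban1984PropagatorsI, (1.60) p.28] -/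
def H (B : W) : V :=
  O.G (O.Qs (O.φinv (O.Bp B)))
    + (O.grad (O.ω B) - O.G (O.Qs (O.φinv (O.grad₁ (O.Lam B))))) + O.Qs (O.P₀ B)

/-- regrouping of (1.60) by linearity: `H_kB = A* + ∂ω + Q_k*B₀`. [folklore] -/
theorem H_eq (B : W) : O.H B = O.Astar B + O.grad (O.ω B) + O.Qs (O.P₀ B) := by
  simp only [H, Astar, map_sub]
  abel

variable {O}

/-- `∂*A* = 0`: `∂*Δ⁻¹Q_k*φ⁻¹B″ = Δ⁻¹Q′_k*∂₁*φ⁻¹B″ = 0` by the normal equation. [folklore] -/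
theorem dv_Astar (hL : O.Laws) (B : W) : O.dv (O.Astar B) = 0 := by
  simp only [Astar, Bp]
  rw [hL.hcomm, hL.h155s, hL.hΛ, map_zero, map_zero]

/-- `ΔA* = Q_k*φ⁻¹B″`. [folklore] -/
theorem Δ_Astar (hL : O.Laws) (B : W) :
    O.Δ (O.Astar B) = O.Qs (O.φinv (O.Bp B - O.grad₁ (O.Lam B))) := by
  simp only [Astar]
  rw [hL.hG]

/-- `∂H_kB = ∂A*` (the `∂ω` and `Q_k*B₀` terms are curl-free). [folklore] -/
theorem curl_H (hL : O.Laws) (B : W) : O.curl (O.H B) = O.curl (O.Astar B) := by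
  rw [H_eq, map_add, map_add, hL.hdd, hL.hB₀c, add_zero, add_zero]

/-- `B″ = B′ − ∂₁λ′ = (B − ∂₁λ′) − P₀(B − ∂₁λ′)` since `P₀∂₁ = 0`. [folklore] -/
theorem Bpp_eq (hL : O.Laws) (B : W) :
    O.Bp B - O.grad₁ (O.Lam B) = (B - O.grad₁ (O.Lam B)) - O.P₀ (B - O.grad₁ (O.Lam B)) := by
  simp only [Bp, map_sub, hL.hP₀g, sub_zero]
  abel

/-- `Q_kA* = B′ − ∂₁λ′` by (1.58) (on `B″ = B′ − ∂₁λ′`, which has no constant part). [folklore] -/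
theorem Q_Astar (hL : O.Laws) (B : W) : O.Q (O.Astar B) = O.Bp B - O.grad₁ (O.Lam B) := by
  simp only [Astar]
  rw [Bpp_eq hL, hL.h158]

/-- **(i) `Q_kH_kB = B`**: `Q_kA* = B′ − ∂₁λ′` by (1.58), `Q_k∂ω = ∂₁Q′_kω = ∂₁λ′` by (1.55) and
`Q′_kΔ⁻²Q′_k*(Q′_kΔ⁻²Q′_k*)⁻¹λ′ = λ′`, `Q_kQ_k*B₀ = B₀`. [cite: Balaban1984PropagatorsI, p.29 after (1.63)] -/
theorem Q_H (hL : O.Laws) (B : W) : O.Q (O.H B) = B := by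
  rw [H_eq, map_add, map_add, Q_Astar hL, hL.h155]
  simp only [ω, Bp]
  rw [hL.hEr, hL.hQB₀]
  abel

/-- (1.38) annihilates `Δ⁻¹Q′_k*E`: `RΔ⁻¹Q′_k*E = Δ⁻¹Q′_k*E − Δ⁻¹Q′_k*E(Q′_kΔ⁻²Q′_k*)E = 0`
(`E = (Q′_kΔ⁻²Q′_k*)⁻¹`). [cite: Balaban1984PropagatorsI, (1.38) p.24] -/
theorem R_Gs_Q's (hL : O.Laws) (t : S₁) : O.R (O.Gs (O.Q's (O.E t))) = 0 := by
  rw [hL.h138, hL.hEl, sub_self]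

/-- **(ii), first half: `∂*H_kB = Δ⁻¹Q′_k*(Q′_kΔ⁻²Q′_k*)⁻¹λ′`** (`∂*A* = 0`, `∂*∂Δ⁻² = Δ⁻¹` on
scalars, `∂*Q_k*B₀ = Q′_k*∂₁*B₀ = 0`). [cite: Balaban1984PropagatorsI, p.29 after (1.63)] -/
theorem dv_H (hL : O.Laws) (B : W) : O.dv (O.H B) = O.Gs (O.Q's (O.E (O.Lam B))) := by
  rw [H_eq, map_add, map_add, dv_Astar hL, zero_add]
  simp only [ω]
  rw [hL.hsc, hL.h155s, hL.hB₀d, map_zero, add_zero]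

/-- **(ii) `R∂*H_kB = 0`.** [cite: Balaban1984PropagatorsI, p.29 after (1.63)] -/
theorem R_dv_H (hL : O.Laws) (B : W) : O.R (O.dv (O.H B)) = 0 := by
  rw [dv_H hL, R_Gs_Q's hL]

/-- **(iii), orthogonality: `⟨∂A′, ∂H_kB⟩ = 0` for every `A′` with `Q_kA′ = 0`** (no gauge condition
on `A′` needed): `⟨∂A′, ∂A*⟩ = ⟨A′, ΔA*⟩ − ⟨∂*A′, ∂*A*⟩ = ⟨Q_kA′, φ⁻¹B″⟩ − 0 = 0`.
[cite: Balaban1984PropagatorsI, p.29 after (1.63)] -/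
theorem inner_curl_H (hL : O.Laws) (B : W) (A' : V) (hA' : O.Q A' = 0) :
    ⟪O.curl A', O.curl (O.H B)⟫_ℝ = 0 := by
  have h := hL.h169 A' (O.Astar B)
  rw [dv_Astar hL, inner_zero_right, add_zero, Δ_Astar hL, ← hL.hadj, hA',
    inner_zero_left] at h
  rw [curl_H hL]
  exact h.symm

/-- the Pythagorean identity behind the minimum: for `Q_kA = B`,
`‖∂A‖² = ‖∂H_kB‖² + ‖∂(A − H_kB)‖²`. [folklore] -/
theorem normSq_curl_eq (hL : O.Laws) (B : W) (A : V) (hA : O.Q A = B) :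
    ‖O.curl A‖ ^ 2 = ‖O.curl (O.H B)‖ ^ 2 + ‖O.curl (A - O.H B)‖ ^ 2 := by
  have hA' : O.Q (A - O.H B) = 0 := by rw [map_sub, hA, Q_H hL, sub_self]
  have horth : ⟪O.curl (O.H B), O.curl (A - O.H B)⟫_ℝ = 0 := by
    rw [real_inner_comm, inner_curl_H hL B _ hA']
  have hsplit : O.curl A = O.curl (O.H B) + O.curl (A - O.H B) := by
    rw [← map_add]; congr 1; abel
  rw [hsplit, norm_add_sq_real, horth, mul_zero, add_zero]

/-- **(iii) `H_kB` minimises `½⟨∂A, ∂A⟩` among all `A` with `Q_kA = B`** (a fortiori on the printed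
hyperplane `{A : Q_kA = B, R∂*A = 0}`, to which `H_kB` belongs by (i), (ii)).
[cite: Balaban1984PropagatorsI, p.29 after (1.63)] -/
theorem energy_H_le (hL : O.Laws) (B : W) (A : V) (hA : O.Q A = B) :
    1 / 2 * ‖O.curl (O.H B)‖ ^ 2 ≤ 1 / 2 * ‖O.curl A‖ ^ 2 := by
  rw [normSq_curl_eq hL B A hA]
  nlinarith [sq_nonneg ‖O.curl (A - O.H B)‖]

variable (O) in
/-- The `B5.HkData` carried by the abstract operators: configurations `A ∈ V`, `B ∈ W`, `Q = Q_k`,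
the gauge condition `R∂*A = 0`, the energy `½⟨∂A, ∂A⟩ = ½‖∂A‖²`, and `H_k` = (1.60). [cite: Balaban1984PropagatorsI, (1.56)–(1.60) pp.27–28] -/
def hkData : HkData where
  CfgA := V
  CfgB := W
  Q := O.Q
  gauge := fun A => O.R (O.dv A) = 0
  energy := fun A => 1 / 2 * ‖O.curl A‖ ^ 2
  H := O.H

/-- **The p. 29 sentence, BY NAME**: under `OpData.Laws`, the `H_k` of (1.60) satisfies
`B5.HkPropsPrinted` — `Q_kH_kB = B`, `R∂*H_kB = 0`, and `½⟨∂H_kB, ∂H_kB⟩ ≤ ½⟨∂A, ∂A⟩` for every `A`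
with `Q_kA = B`, `R∂*A = 0`. [cite: Balaban1984PropagatorsI, p.29 after (1.63)] -/
theorem hkPropsPrinted_of_laws (hL : O.Laws) : HkPropsPrinted O.hkData :=
  fun B => ⟨Q_H hL B, R_dv_H hL B, fun A hA _ => energy_H_le hL B A hA⟩

end OpData

end Literature.MathematicalPhysics.QuantumFieldTheory.Balaban1983to89.B5HkProperties

end
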